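import Literature.AlgebraicGeometry.Resolution.RegularCentreBlowupSeqIntegral
import Literature.AlgebraicGeometry.Resolution.OrderSemicontinuity
import Literature.AlgebraicGeometry.Resolution.J2Blowup
import HarnessLib

/-!
# The stages of Cossart–Piltant's principalization: `Σ` is closed of dimension `≤ 1`

Topic: `Literature/AlgebraicGeometry/Resolution`. [CoP1] = Cossart–Piltant, J. Algebra 320
(2008), proof of Prop. 4.2: "`V(J)` has codimension at least two in `X` … `μ := sup_x {m(x)}`,
`Σ := {x ∈ X | m(x) = μ}` … Then `Σ` is a closed subset of `X` of dimension zero or one" — PROVED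
on every stage `ρ : X → 𝒮` of a Cossart–Piltant sequence (`IsRegularCentreBlowupSeq ρ I`,
`I ≠ 0`) over a regular excellent integral Noetherian scheme `𝒮` of dimension `≤ 3` (the setting
of the hypothesis `h44` of `exists_principalization_of_prop44`, `PrincipalizationOfProp44.lean`),
assembling `RegularBlowup.lean` (regularity), `J2Blowup.lean` (J-2), `OrderSemicontinuity.lean`
(upper semicontinuity of the order), `RegularCentreBlowupSeqIntegral.lean` and
`BlowupDimension.lean` (integrality, dimension `≤ 3`), `NonPrincipalLocus.lean` (dimension count):

* `IsRegularCentreBlowupSeq.topologicalKrullDim_support_le_one` — an ideal sheaf on a stage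
  whose support has codimension `≥ 2` has support of dimension `≤ 1`;
* `IsRegularCentreBlowupSeq.isClosed_setOf_idealOrder_eq` — `Σ = {ord_x K = μ}` is closed for
  `μ` the maximal order of `K ≠ 0` on a stage;
* `IsRegularCentreBlowupSeq.exists_isGreatest_idealOrder` — the maximal order is attained;
* `IsRegularCentreBlowupSeq.topologicalKrullDim_setOf_idealOrder_eq_le_one` — **`dim Σ ≤ 1`**
  when moreover `V(K)` has codimension `≥ 2` and `μ ≥ 1`.

## Sources

* V. Cossart, O. Piltant, J. Algebra 320 (2008), proof of Prop. 4.2, p. 7. [CossartPiltant2008]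
-/

noncomputable section

open CategoryTheory AlgebraicGeometry TopologicalSpace IsLocalRing

namespace Literature.AlgebraicGeometry.Resolution

universe u

open Scheme.IdealSheafData

variable {X S : Scheme.{u}} {ρ : X ⟶ S} {I : S.IdealSheafData}

/-- **On a stage over a scheme of dimension `≤ 3`, a closed set all of whose points have
codimension `> 1` has dimension `≤ 1`**: codimensions on the stage are `≤ 3`
(`IsRegularCentreBlowupSeq.coheight_le`) and `height + coheight ≤ dim ≤ 3`.
[cite: CossartPiltant2008, proof of Prop. 4.2] -/
theorem IsRegularCentreBlowupSeq.topologicalKrullDim_le_one_of_forall_one_lt_coheight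
    [IsIntegral S] [IsLocallyNoetherian S] (hρ : IsRegularCentreBlowupSeq ρ I) (hI : I ≠ ⊥)
    (hdim : topologicalKrullDim S ≤ 3) {Z : Set X} (hZ : IsClosed Z)
    (hcodim : ∀ x ∈ Z, 1 < Order.coheight x) : topologicalKrullDim Z ≤ 1 := by
  have hdimX : topologicalKrullDim X ≤ 3 :=
    hρ.topologicalKrullDim_le inferInstance inferInstance hI (n := 3) hdim
  have := topologicalKrullDim_le_of_forall_height_le hZ 1 fun x hx => by
    have h1 : (1 : ℕ∞) < Order.coheight x := hcodim x hx
    have h2 : Order.height x + Order.coheight x ≤ 3 := by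
      have := (coe_height_add_coheight_le_topologicalKrullDim x).trans hdimX
      rwa [← WithBot.coe_ofNat, WithBot.coe_le_coe] at this
    have hc : Order.coheight x ≤ 3 := hρ.coheight_le hI hdim x
    obtain ⟨c, hc'⟩ := ENat.ne_top_iff_exists.mp (ne_top_of_le_ne_top (by decide) hc)
    have hh : Order.height x ≠ ⊤ := by
      intro h
      rw [h, top_add, top_le_iff] at h2
      exact ENat.coe_ne_top 3 h2
    obtain ⟨a, ha'⟩ := ENat.ne_top_iff_exists.mp hh
    rw [← hc', ← ha'] at h2
    rw [← hc'] at h1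
    rw [← ha']
    have h1' : 1 < c := by exact_mod_cast h1
    have h2' : a + c ≤ 3 := by exact_mod_cast h2
    exact_mod_cast (show a ≤ 1 by omega)
  exact_mod_cast this

/-- In particular **the support of an ideal sheaf of codimension `≥ 2` on a stage has dimension
`≤ 1`** ([CoP1]: "`V(J)` has codimension at least two … `Σ` … of dimension zero or one").
[cite: CossartPiltant2008, proof of Prop. 4.2] -/
theorem IsRegularCentreBlowupSeq.topologicalKrullDim_support_le_one [IsIntegral S]
    [IsLocallyNoetherian S] (hρ : IsRegularCentreBlowupSeq ρ I) (hI : I ≠ ⊥)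
    (hdim : topologicalKrullDim S ≤ 3) {K : X.IdealSheafData}
    (hK : ∀ x ∈ K.support, 1 < Order.coheight x) :
    topologicalKrullDim (K.support : Set X) ≤ 1 :=
  hρ.topologicalKrullDim_le_one_of_forall_one_lt_coheight hI hdim K.support.isClosed hK

/-- **The maximal order of a non-zero ideal sheaf on a stage is attained** (stages are integral,
Noetherian, regular and J-2). [cite: CossartPiltant2008, proof of Prop. 4.2] -/
theorem IsRegularCentreBlowupSeq.exists_isGreatest_idealOrder [IsIntegral S] [IsNoetherian S]
    (hS : Scheme.IsRegular S) (hE : Scheme.IsExcellent S) (hρ : IsRegularCentreBlowupSeq ρ I)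
    (hI : I ≠ ⊥) {K : X.IdealSheafData} (hK : K ≠ ⊥) :
    ∃ μ : ℕ, (∀ x : X, idealOrder K x ≤ μ) ∧ ∃ x : X, idealOrder K x = μ := by
  haveI := hρ.isIntegral hI
  haveI := hρ.isNoetherian inferInstance
  exact exists_isGreatest_idealOrder_of_isJ2 (hρ.isRegular hS) (hρ.isJ2Ring_sections hE) hK

/-- **`Σ = {x | ord_x K = μ}` is closed on a stage**, for `μ` an upper bound of the order of
`K ≠ 0`. [cite: CossartPiltant2008, proof of Prop. 4.2] -/
theorem IsRegularCentreBlowupSeq.isClosed_setOf_idealOrder_eq [IsIntegral S] [IsNoetherian S]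
    (hS : Scheme.IsRegular S) (hE : Scheme.IsExcellent S) (hρ : IsRegularCentreBlowupSeq ρ I)
    (hI : I ≠ ⊥) {K : X.IdealSheafData} (hK : K ≠ ⊥) {μ : ℕ} (hμ : ∀ x : X, idealOrder K x ≤ μ) :
    IsClosed {x : X | idealOrder K x = μ} := by
  haveI := hρ.isIntegral hI
  haveI := hρ.isNoetherian inferInstance
  exact isClosed_setOf_idealOrder_eq_of_forall_le_of_isJ2 (hρ.isRegular hS)
    (hρ.isJ2Ring_sections hE) hK hμ

/-- **"`Σ` is a closed subset of `X` of dimension zero or one"** on every stage: for `K ≠ 0`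
with `V(K)` of codimension `≥ 2`, `μ ≥ 1` an upper bound of the order, `dim {ord_x K = μ} ≤ 1`
(it is a closed subset of `V(K)`). [cite: CossartPiltant2008, proof of Prop. 4.2] -/
theorem IsRegularCentreBlowupSeq.topologicalKrullDim_setOf_idealOrder_eq_le_one [IsIntegral S]
    [IsNoetherian S] (hS : Scheme.IsRegular S) (hE : Scheme.IsExcellent S)
    (hdim : topologicalKrullDim S ≤ 3) (hρ : IsRegularCentreBlowupSeq ρ I) (hI : I ≠ ⊥)
    {K : X.IdealSheafData} (hKc : ∀ x ∈ K.support, 1 < Order.coheight x) {μ : ℕ} (hμ1 : 1 ≤ μ)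
    (hμ : ∀ x : X, idealOrder K x ≤ μ) :
    topologicalKrullDim {x : X | idealOrder K x = μ} ≤ 1 := by
  haveI := hρ.isIntegral hI
  have hK : K ≠ ⊥ := by
    intro h
    have hmem : (⊤ : X) ∈ K.support := by rw [h, Scheme.IdealSheafData.support_bot]; trivial
    have := hKc _ hmem
    rw [Order.coheight_top] at this
    exact not_lt_bot this
  refine hρ.topologicalKrullDim_le_one_of_forall_one_lt_coheight hI hdim
    (hρ.isClosed_setOf_idealOrder_eq hS hE hI hK hμ) fun x hx => hKc x ?_
  -- `x ∈ V(K)` since `ord_x K = μ ≥ 1`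
  rw [Set.mem_setOf_eq] at hx
  refine (one_le_idealOrder_iff K x).mp ?_
  rw [hx]
  exact_mod_cast hμ1

end Literature.AlgebraicGeometry.Resolution

end
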